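import Literature.NumberTheory.EllipticCurves.MaxUnramifiedIntegersProofs
import Literature.NumberTheory.EllipticCurves.NeronComponentIndexTypeIIIProofs
import Literature.NumberTheory.EllipticCurves.NeronComponentIndexTypeIIIstarProofs
import Literature.NumberTheory.EllipticCurves.NeronComponentIndexTypeIVProofs
import Literature.NumberTheory.EllipticCurves.NeronComponentIndexTypeIVstarProofs
import Literature.NumberTheory.EllipticCurves.NeronComponentIndexTypeI0starProofs
import Literature.NumberTheory.EllipticCurves.NeronComponentIndexTypeInstarProofs
import Literature.NumberTheory.DiophantineGeometry.TateAlgorithmAdditiveProofs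
import Literature.NumberTheory.EllipticCurves.InertiaInvariantsKodairaNeronAdditiveProofs
import Literature.RingTheory.DiscreteValuationRing.AdicCompletionResidueField
import Mathlib.NumberTheory.NumberField.Ideal.Basic
import HarnessLib

/-!
# Kodaira–Néron over `K_v^nr` at the additive places: `E(K_v^nr)/E₀(K_v^nr)` is finite
# (Silverman *ATAEC* IV.9.4 transported to the henselian valuation ring of `K_v^nr`)

`Proofs` file (theorems only, no definitions, no named facts) in topic
`NumberTheory/EllipticCurves`, landed by the tenured seat of bsd.S15
(`Literature.NumberTheory.EllipticCurves.conductorNorm_eq_artinConductorNat`, `BSDConductor`).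
Second file (after `MaxUnramifiedIntegersProofs`) of the proof of the **Kodaira–Néron finiteness
over `K_v^nr`** — the named fact `WeierstrassCurve.kodairaNeron_exists_finset_reducesToNonsingular`
of `KodairaNeronUnramified` (Silverman, *AEC*, Cor. VII.6.2 as used in the proof of Thm. VII.7.1:
"the quotient group `E(K^nr)/E₀(K^nr)` is finite from (VII.6.2)"; *ATAEC* Cor. IV.9.2(d)) — **for
the minimal models at the places of additive reduction**
(`WeierstrassCurve.kodairaNeron_exists_finset_reducesToNonsingular_of_hasAdditiveReductionAt`),
which is the input of the additive case of *ATAEC* Thm. IV.10.2(a)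
(`InertiaInvariantsKodairaNeronAdditiveProofs`, `InertiaInvariantsMultiplicativeProofs`).

Let `K` be a number field, `v` a finite place, `𝓞_v ⊆ K_v`, `w = |·|_v` the spectral valuation of
`K̄_v`, `K_v^nr = maxUnramified K_v` and `𝒪ⁿʳ` its valuation ring (the expression
`(w.comap (algebraMap K_v^nr K̄_v)).valuationSubring`, a henselian discrete valuation ring by
`MaxUnramifiedIntegersProofs`), `φ : 𝓞_v → 𝒪ⁿʳ` the structure map
(`exists_ringHom_adicCompletionIntegers_unrIntegers`, characterised by `hφ`).

## The proof

1. *The local index over `𝒪ⁿʳ`.*  For the integral minimal model `X₀` over `𝓞_v`, Tate's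
   algorithm (`WeierstrassCurve.kodairaSymbolOfMinimal`, `TateAlgorithm`) returns an additive type
   (`isAdditive_kodairaSymbolAt_iff_holds`); the normal form `D • X₀` of the type over `𝓞_v`
   (`exists_smul_of_kodairaSymbolOfMinimal_eq_*` of `NeronComponentIndexType*Proofs` /
   `TateAlgorithmIstarSuccNormalFormProofs`, residue field of `𝓞_v` perfect) keeps its defining
   `π`-adic conditions in `𝒪ⁿʳ` because `𝒪ⁿʳ/𝓞_v` is unramified (`map_mem_maximalIdeal_pow_iff`;
   for the root counts of Steps 6 and 8, `distinctRootCount_cubicStep6_map_eq_three`,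
   `distinctRootCount_quadraticStep8_map_eq_two`: the coefficients `a_{i,j}` change by powers of the
   unit `ū`, `redCoeff_map_eq`, and the discriminants are weighted-homogeneous), so the elementary
   index computations `index_*_of_normalForm_*` of those files, stated over an arbitrary henselian
   discrete valuation ring, give `[J(K_v^nr) : E₀] ∈ {1, 2, 3, 4}` for `J = X₀ ⊗ 𝒪ⁿʳ`
   (`index_nonsingularReductionSubgroup_smul`; for types `II`, `II*` every point has nonsingular
   reduction, `a₆_mem_sq_of_equation`, `dvd_a₆_of_equation_IIstar`).  No Néron model and no
   minimality over `𝒪ⁿʳ` is used: Tate's algorithm is only ever run over `𝓞_v`.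
2. *Representatives* of the finitely many classes (`QuotientAddGroup.mk_out_eq_mul`) are pushed into
   `X(K̄_v)` along `J ⊗ K_v^nr = X ⊗ K_v^nr` and `K_v^nr ⊆ K̄_v`; their coordinates lie in `K_v^nr`,
   the fixed field of `I_𝔐` (`mem_maxUnramified_iff_forall_inertia`), by which also
3. *the `I_𝔐`-fixed points of `X(K̄_v)` come from `X(K_v^nr)`*; and
4. *`E₀` over `𝒪ⁿʳ` maps into `E₀` over `𝒪_w`* (`Literature.NumberTheory.EllipticCurves.ReducesToNonsingular`
   for `|·|_v`: bridge `reducesToNonsingular_iff_hasNonsingularReduction` on the `𝒪_w`-model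
   `J ⊗ 𝒪_w`, the residue field of `𝒪ⁿʳ` embedding into that of `𝒪_w`, `Affine.map_nonsingular`).

## References

* J. H. Silverman, *Advanced Topics in the Arithmetic of Elliptic Curves*, GTM 151 (1994), §IV.9:
  Cor. 9.2(d) (PDF p. 340), Algorithm 9.4 and its proof (pp. 341–350), Table 4.1 (p. 343).
  [SilvermanATAEC1994]
* J. H. Silverman, *The Arithmetic of Elliptic Curves*, 2nd ed. (2009), Cor. VII.6.2 and the
  proof of Thm. VII.7.1 (PDF pp. 177–179). [SilvermanAEC2009]
* J. Tate, *Algorithm for determining the type of a singular fiber in an elliptic pencil*,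
  LNM 476 (1975). [Tate1975]

## Design

No definitions; theorems only; `open scoped Classical NNReal`; one universe `u`; the spectral
valuation is quantified with `hw` as in `SelmerFiniteProofs`; `𝒪ⁿʳ`, `K_v^nr`, `𝓞_v` are spelled
out as expressions in the code.  The index theorems of `NeronComponentIndexType*Proofs` are stated
over an arbitrary field with the classical `DecidableEq` on it; `K_v^nr`, a subtype of `K̄_v`, would
get `Subtype.instDecidableEq` instead, so the main proof fixes the classical instance with `letI`
before mentioning any group of `K_v^nr`-points.  `set_option maxHeartbeats` is raised for the
transfer theorems and the main theorem (many coercions).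
-/

noncomputable section

open scoped Classical NNReal
open NumberField IsDedekindDomain Field Polynomial IsLocalRing

universe u

namespace IsDedekindDomain.HeightOneSpectrum

open Literature.NumberTheory.EllipticCurves Literature.NumberTheory.EllipticCurves.LocalIndex
  Literature.NumberTheory.GaloisRepresentations
  Literature.NumberTheory.GaloisRepresentations.IsNonarchimedeanLocalField
  Literature.NumberTheory.DiophantineGeometry Literature.NumberTheory.DiophantineGeometry.TateAlgorithm
  Literature.NumberTheory.DiophantineGeometry.KodairaSymbol

variable {K : Type u} [Field K] [NumberField K] {v : HeightOneSpectrum (𝓞 K)}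
  {w : Valuation (AlgebraicClosure (v.adicCompletion K)) ℝ≥0}
  (hw : ∀ x, (w x : ℝ) = spectralNorm (v.adicCompletion K) (AlgebraicClosure (v.adicCompletion K)) x)



/-! ## Root counts of the auxiliary polynomials under `𝓞_v → 𝒪ⁿʳ` -/

/-- **`divPow` along `φ : 𝓞_v → 𝒪ⁿʳ`**: if `ϖᵥʲ ∣ a` then `π^{-j} φ(a) = uʲ φ(ϖᵥ^{-j} a)` in `𝒪ⁿʳ`,
where `π` is the chosen uniformiser of `𝒪ⁿʳ` and `φ ϖᵥ = π u` (`φ ϖᵥ` is a uniformiser of `𝒪ⁿʳ`,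
the extension being unramified). [folklore] -/
theorem divPow_map_eq (φ : (v.adicCompletionIntegers K) →+* (Valuation.valuationSubring (Valuation.comap (algebraMap (maxUnramified (v.adicCompletion K)) (AlgebraicClosure (v.adicCompletion K))) w))) [IsDiscreteValuationRing (Valuation.valuationSubring (Valuation.comap (algebraMap (maxUnramified (v.adicCompletion K)) (AlgebraicClosure (v.adicCompletion K))) w))] {u : (Valuation.valuationSubring (Valuation.comap (algebraMap (maxUnramified (v.adicCompletion K)) (AlgebraicClosure (v.adicCompletion K))) w))}
    (hu : φ (uniformizer (v.adicCompletionIntegers K)) = uniformizer (Valuation.valuationSubring (Valuation.comap (algebraMap (maxUnramified (v.adicCompletion K)) (AlgebraicClosure (v.adicCompletion K))) w)) * u) {a : (v.adicCompletionIntegers K)} {j : ℕ}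
    (h : uniformizer (v.adicCompletionIntegers K) ^ j ∣ a) : divPow (φ a) j = u ^ j * φ (divPow a j) := by
  have hπ0 : uniformizer (Valuation.valuationSubring (Valuation.comap (algebraMap (maxUnramified (v.adicCompletion K)) (AlgebraicClosure (v.adicCompletion K))) w)) ≠ 0 := irreducible_uniformizer.ne_zero
  have e1 : φ a = uniformizer (Valuation.valuationSubring (Valuation.comap (algebraMap (maxUnramified (v.adicCompletion K)) (AlgebraicClosure (v.adicCompletion K))) w)) ^ j * (u ^ j * φ (divPow a j)) := by
    conv_lhs => rw [divPow_spec h]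
    rw [map_mul, map_pow, hu, mul_pow, mul_assoc]
  have h' : uniformizer (Valuation.valuationSubring (Valuation.comap (algebraMap (maxUnramified (v.adicCompletion K)) (AlgebraicClosure (v.adicCompletion K))) w)) ^ j ∣ φ a := ⟨_, e1⟩
  have e2 := divPow_spec h'
  exact mul_left_cancel₀ (pow_ne_zero j hπ0) (e2.symm.trans e1)

/-- `redCoeff` along `φ`: `(φ a)_{·,j} = ūʲ · \overline{φ(ϖᵥ^{-j}a)}`. [folklore] -/
theorem redCoeff_map_eq (φ : (v.adicCompletionIntegers K) →+* (Valuation.valuationSubring (Valuation.comap (algebraMap (maxUnramified (v.adicCompletion K)) (AlgebraicClosure (v.adicCompletion K))) w))) [IsDiscreteValuationRing (Valuation.valuationSubring (Valuation.comap (algebraMap (maxUnramified (v.adicCompletion K)) (AlgebraicClosure (v.adicCompletion K))) w))] {u : (Valuation.valuationSubring (Valuation.comap (algebraMap (maxUnramified (v.adicCompletion K)) (AlgebraicClosure (v.adicCompletion K))) w))}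
    (hu : φ (uniformizer (v.adicCompletionIntegers K)) = uniformizer (Valuation.valuationSubring (Valuation.comap (algebraMap (maxUnramified (v.adicCompletion K)) (AlgebraicClosure (v.adicCompletion K))) w)) * u) {a : (v.adicCompletionIntegers K)} {j : ℕ}
    (h : uniformizer (v.adicCompletionIntegers K) ^ j ∣ a) :
    redCoeff (φ a) j = residue (Valuation.valuationSubring (Valuation.comap (algebraMap (maxUnramified (v.adicCompletion K)) (AlgebraicClosure (v.adicCompletion K))) w)) u ^ j * residue (Valuation.valuationSubring (Valuation.comap (algebraMap (maxUnramified (v.adicCompletion K)) (AlgebraicClosure (v.adicCompletion K))) w)) (φ (divPow a j)) := by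
  rw [redCoeff, divPow_map_eq φ hu h, map_mul, map_pow]

include hw in
/-- **Residues of `𝓞_v`-elements vanish in `𝒪ⁿʳ` iff they vanish in `𝓞_v`** (`φ⁻¹(𝔪ⁿʳ) = 𝓂_v`).
[folklore] -/
theorem residue_map_ne_zero_iff {φ : (v.adicCompletionIntegers K) →+* (Valuation.valuationSubring (Valuation.comap (algebraMap (maxUnramified (v.adicCompletion K)) (AlgebraicClosure (v.adicCompletion K))) w))}
    (hφ : ∀ a, (((φ a : (Valuation.valuationSubring (Valuation.comap (algebraMap (maxUnramified (v.adicCompletion K)) (AlgebraicClosure (v.adicCompletion K))) w))) : (maxUnramified (v.adicCompletion K))) : (AlgebraicClosure (v.adicCompletion K))) = algebraMap (v.adicCompletion K) (AlgebraicClosure (v.adicCompletion K)) (a : (v.adicCompletion K))) (a : (v.adicCompletionIntegers K)) :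
    residue (Valuation.valuationSubring (Valuation.comap (algebraMap (maxUnramified (v.adicCompletion K)) (AlgebraicClosure (v.adicCompletion K))) w)) (φ a) ≠ 0 ↔ residue (v.adicCompletionIntegers K) a ≠ 0 := by
  rw [Ne, Ne, IsLocalRing.residue_eq_zero_iff, IsLocalRing.residue_eq_zero_iff,
    map_mem_maximalIdeal_iff hw hφ]


/-- The cubic discriminant of Step 6 of Tate's algorithm is weighted-homogeneous of weight `6`.
[folklore] -/
theorem _root_.Literature.NumberTheory.EllipticCurves.cubicDiscr_smul {F : Type*} [CommRing F]
    (u p q r : F) :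
    (u * p) ^ 2 * (u ^ 2 * q) ^ 2 - 4 * (u ^ 2 * q) ^ 3 - 4 * (u * p) ^ 3 * (u ^ 3 * r) -
        27 * (u ^ 3 * r) ^ 2 + 18 * (u * p) * (u ^ 2 * q) * (u ^ 3 * r) =
      u ^ 6 * (p ^ 2 * q ^ 2 - 4 * q ^ 3 - 4 * p ^ 3 * r - 27 * r ^ 2 + 18 * p * q * r) := by
  ring

/-- Rescaling the coefficients of the Step-6 cubic by `u, u², u³` (`u ≠ 0`) does not create a
multiple root. [folklore] -/
theorem _root_.Literature.NumberTheory.EllipticCurves.cubicDiscr_ne_zero_of_eq {F : Type*} [Field F]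
    {A B C x y z u : F} (hA : A = u ^ 1 * x) (hB : B = u ^ 2 * y) (hC : C = u ^ 3 * z)
    (hu : u ≠ 0) (h : x ^ 2 * y ^ 2 - 4 * y ^ 3 - 4 * x ^ 3 * z - 27 * z ^ 2 + 18 * x * y * z ≠ 0) :
    A ^ 2 * B ^ 2 - 4 * B ^ 3 - 4 * A ^ 3 * C - 27 * C ^ 2 + 18 * A * B * C ≠ 0 := by
  subst hA hB hC
  rw [pow_one, cubicDiscr_smul]
  exact mul_ne_zero (pow_ne_zero 6 hu) h

/-- Rescaling the coefficients of the Step-8 quadratic by `u², u⁴` (`u ≠ 0`) does not create a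
double root. [folklore] -/
theorem _root_.Literature.NumberTheory.EllipticCurves.quadDiscr_ne_zero_of_eq {F : Type*} [Field F]
    {A C x z u : F} (hA : A = u ^ 2 * x) (hC : C = u ^ 4 * z) (hu : u ≠ 0)
    (h : x ^ 2 + 4 * z ≠ 0) : A ^ 2 + 4 * C ≠ 0 := by
  subst hA hC
  have e : (u ^ 2 * x) ^ 2 + 4 * (u ^ 4 * z) = u ^ 4 * (x ^ 2 + 4 * z) := by ring
  rw [e]
  exact mul_ne_zero (pow_ne_zero 4 hu) h

/-- Root count of the Step-8 quadratic `Y² + aY − c`: two distinct roots iff `a² + 4c ≠ 0`, in any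
characteristic (`card_aroots_toFinset_sq_add_sub_eq_two_iff_ne_zero`). [folklore] -/
theorem _root_.Literature.NumberTheory.EllipticCurves.distinctRootCount_sq_add_sub_eq_two_iff
    {R : Type*} [CommRing R] [IsDomain R] [IsDiscreteValuationRing R] (a c : ResidueField R) :
    distinctRootCount (X ^ 2 + C a * X - C c) = 2 ↔ a ^ 2 + 4 * c ≠ 0 := by
  unfold distinctRootCount
  convert card_aroots_toFinset_sq_add_sub_eq_two_iff_ne_zero
    (L := AlgebraicClosure (ResidueField R)) a c

set_option maxHeartbeats 800000 in
include hw in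
/-- **Step 6 is insensitive to `𝓞_v → 𝒪ⁿʳ`**: for `V` over `𝓞_v` with `π ∣ a₂`, `π² ∣ a₄`,
`π³ ∣ a₆`, if the cubic `P(T) = T³ + a₂,₁T² + a₄,₂T + a₆,₃` of `V` has three distinct roots in
`k̄_v`, so has the cubic of `V ⊗ 𝒪ⁿʳ` (its coefficients are `ū a₂,₁, ū² a₄,₂, ū³ a₆,₃` with
`ū ≠ 0`, `redCoeff_map_eq`, so its discriminant is `ū⁶` times the image of that of `P`, which is
a unit of `𝓞_v`, hence of `𝒪ⁿʳ`). [cite: SilvermanATAEC1994, IV.9.4 Step 6] -/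
theorem distinctRootCount_cubicStep6_map_eq_three {φ : (v.adicCompletionIntegers K) →+* (Valuation.valuationSubring (Valuation.comap (algebraMap (maxUnramified (v.adicCompletion K)) (AlgebraicClosure (v.adicCompletion K))) w))}
    (hφ : ∀ a, (((φ a : (Valuation.valuationSubring (Valuation.comap (algebraMap (maxUnramified (v.adicCompletion K)) (AlgebraicClosure (v.adicCompletion K))) w))) : (maxUnramified (v.adicCompletion K))) : (AlgebraicClosure (v.adicCompletion K))) = algebraMap (v.adicCompletion K) (AlgebraicClosure (v.adicCompletion K)) (a : (v.adicCompletion K)))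
    [IsDiscreteValuationRing (Valuation.valuationSubring (Valuation.comap (algebraMap (maxUnramified (v.adicCompletion K)) (AlgebraicClosure (v.adicCompletion K))) w))] (V : WeierstrassCurve (v.adicCompletionIntegers K))
    (h2 : V.a₂ ∈ maximalIdeal (v.adicCompletionIntegers K)) (h4 : V.a₄ ∈ maximalIdeal (v.adicCompletionIntegers K) ^ 2)
    (h6 : V.a₆ ∈ maximalIdeal (v.adicCompletionIntegers K) ^ 3) (h3 : distinctRootCount (cubicStep6 V) = 3) :
    distinctRootCount (cubicStep6 (V.map φ)) = 3 := by
  obtain ⟨u, hu⟩ := IsDiscreteValuationRing.associated_of_irreducible _ irreducible_uniformizer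
    (irreducible_map_of_coe_eq_algebraMap hw hφ (irreducible_uniformizer (R := (v.adicCompletionIntegers K))))
  have hu' : φ (uniformizer (v.adicCompletionIntegers K)) = uniformizer (Valuation.valuationSubring (Valuation.comap (algebraMap (maxUnramified (v.adicCompletion K)) (AlgebraicClosure (v.adicCompletion K))) w)) * u := hu.symm
  have hd2 : uniformizer (v.adicCompletionIntegers K) ^ 1 ∣ V.a₂ := by rw [pow_one]; exact mem_maximalIdeal_iff_dvd.mp h2
  have hd4 : uniformizer (v.adicCompletionIntegers K) ^ 2 ∣ V.a₄ := mem_maximalIdeal_pow_iff_dvd.mp h4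
  have hd6 : uniformizer (v.adicCompletionIntegers K) ^ 3 ∣ V.a₆ := mem_maximalIdeal_pow_iff_dvd.mp h6
  have hū : residue (Valuation.valuationSubring (Valuation.comap (algebraMap (maxUnramified (v.adicCompletion K)) (AlgebraicClosure (v.adicCompletion K))) w)) (u : (Valuation.valuationSubring (Valuation.comap (algebraMap (maxUnramified (v.adicCompletion K)) (AlgebraicClosure (v.adicCompletion K))) w))) ≠ 0 := (residue_ne_zero_iff_isUnit _).mpr u.isUnit
  rw [cubicStep6, distinctRootCount_cubic_eq_three_iff] at h3 ⊢
  have hres : residue (v.adicCompletionIntegers K) (divPow V.a₂ 1 ^ 2 * divPow V.a₄ 2 ^ 2 - 4 * divPow V.a₄ 2 ^ 3 -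
      4 * divPow V.a₂ 1 ^ 3 * divPow V.a₆ 3 - 27 * divPow V.a₆ 3 ^ 2 +
      18 * divPow V.a₂ 1 * divPow V.a₄ 2 * divPow V.a₆ 3) ≠ 0 := by
    simp only [map_sub, map_add, map_mul, map_pow, map_ofNat]
    exact h3
  have hres' := (residue_map_ne_zero_iff hw hφ _).mpr hres
  simp only [map_sub, map_add, map_mul, map_pow, map_ofNat] at hres'
  exact cubicDiscr_ne_zero_of_eq (redCoeff_map_eq φ hu' hd2) (redCoeff_map_eq φ hu' hd4)
    (redCoeff_map_eq φ hu' hd6) hū hres'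

set_option maxHeartbeats 800000 in
include hw in
/-- **Step 8 is insensitive to `𝓞_v → 𝒪ⁿʳ`**: for `V` over `𝓞_v` with `π² ∣ a₃`, `π⁴ ∣ a₆`, if
the quadratic `Y² + a₃,₂Y − a₆,₄` of `V` has two distinct roots in `k̄_v`, so has that of
`V ⊗ 𝒪ⁿʳ` (coefficients `ū² a₃,₂`, `ū⁴ a₆,₄`; `a² + 4c ↦ ū⁴ (a² + 4c)`).
[cite: SilvermanATAEC1994, IV.9.4 Step 8] -/
theorem distinctRootCount_quadraticStep8_map_eq_two {φ : (v.adicCompletionIntegers K) →+* (Valuation.valuationSubring (Valuation.comap (algebraMap (maxUnramified (v.adicCompletion K)) (AlgebraicClosure (v.adicCompletion K))) w))}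
    (hφ : ∀ a, (((φ a : (Valuation.valuationSubring (Valuation.comap (algebraMap (maxUnramified (v.adicCompletion K)) (AlgebraicClosure (v.adicCompletion K))) w))) : (maxUnramified (v.adicCompletion K))) : (AlgebraicClosure (v.adicCompletion K))) = algebraMap (v.adicCompletion K) (AlgebraicClosure (v.adicCompletion K)) (a : (v.adicCompletion K)))
    [IsDiscreteValuationRing (Valuation.valuationSubring (Valuation.comap (algebraMap (maxUnramified (v.adicCompletion K)) (AlgebraicClosure (v.adicCompletion K))) w))] (V : WeierstrassCurve (v.adicCompletionIntegers K))
    (h3 : V.a₃ ∈ maximalIdeal (v.adicCompletionIntegers K) ^ 2) (h6 : V.a₆ ∈ maximalIdeal (v.adicCompletionIntegers K) ^ 4)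
    (h2 : distinctRootCount (quadraticStep8 V) = 2) :
    distinctRootCount (quadraticStep8 (V.map φ)) = 2 := by
  obtain ⟨u, hu⟩ := IsDiscreteValuationRing.associated_of_irreducible _ irreducible_uniformizer
    (irreducible_map_of_coe_eq_algebraMap hw hφ (irreducible_uniformizer (R := (v.adicCompletionIntegers K))))
  have hu' : φ (uniformizer (v.adicCompletionIntegers K)) = uniformizer (Valuation.valuationSubring (Valuation.comap (algebraMap (maxUnramified (v.adicCompletion K)) (AlgebraicClosure (v.adicCompletion K))) w)) * u := hu.symm
  have hd3 : uniformizer (v.adicCompletionIntegers K) ^ 2 ∣ V.a₃ := mem_maximalIdeal_pow_iff_dvd.mp h3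
  have hd6 : uniformizer (v.adicCompletionIntegers K) ^ 4 ∣ V.a₆ := mem_maximalIdeal_pow_iff_dvd.mp h6
  have hū : residue (Valuation.valuationSubring (Valuation.comap (algebraMap (maxUnramified (v.adicCompletion K)) (AlgebraicClosure (v.adicCompletion K))) w)) (u : (Valuation.valuationSubring (Valuation.comap (algebraMap (maxUnramified (v.adicCompletion K)) (AlgebraicClosure (v.adicCompletion K))) w))) ≠ 0 := (residue_ne_zero_iff_isUnit _).mpr u.isUnit
  rw [quadraticStep8, distinctRootCount_sq_add_sub_eq_two_iff] at h2 ⊢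
  have hres : residue (v.adicCompletionIntegers K) (divPow V.a₃ 2 ^ 2 + 4 * divPow V.a₆ 4) ≠ 0 := by
    simp only [map_add, map_mul, map_pow, map_ofNat]
    exact h2
  have hres' := (residue_map_ne_zero_iff hw hφ _).mpr hres
  simp only [map_add, map_mul, map_pow, map_ofNat] at hres'
  exact quadDiscr_ne_zero_of_eq (redCoeff_map_eq φ hu' hd3) (redCoeff_map_eq φ hu' hd6) hū
    hres'

/-! ## Kodaira–Néron over `K_v^nr` at the additive places -/

omit hw in
/-- `(congrEquiv h).symm` is the identity on coordinates. [folklore] -/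
theorem _root_.WeierstrassCurve.Affine.Point.congrEquiv_symm_some {F : Type*} [Field F]
    [DecidableEq F] {W₁ W₂ : WeierstrassCurve F} (h : W₁ = W₂) {x y : F}
    (hP : W₂.toAffine.Nonsingular x y) :
    (WeierstrassCurve.Affine.Point.congrEquiv h).symm (.some x y hP) = .some x y (h ▸ hP) := by
  subst h
  rfl

set_option maxHeartbeats 4000000 in
/-- **Kodaira–Néron finiteness over `K_v^nr` at a place of additive reduction** — the named fact
`WeierstrassCurve.kodairaNeron_exists_finset_reducesToNonsingular` of `KodairaNeronUnramified`
(Silverman, *AEC*, Cor. VII.6.2 as applied over `K^nr` in the proof of Thm. VII.7.1: "the quotient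
group `E(K^nr)/E₀(K^nr)` is finite"; *ATAEC* Cor. IV.9.2(d)) **for the minimal model
`W.localMinimalModel v` of an elliptic curve `E/K` with additive reduction at `v`.**

Proof.  (1) *The local index over `𝒪ⁿʳ`.*  Let `X₀` be the integral minimal model over `𝓞_v`,
`φ : 𝓞_v → 𝒪ⁿʳ` (`MaxUnramifiedIntegersProofs`) and `J = X₀ ⊗ 𝒪ⁿʳ`.  Tate's algorithm on `X₀`
returns an additive type (`isAdditive_kodairaSymbolAt_iff_holds`); its normal form `D • X₀` over
`𝓞_v` (`exists_smul_of_kodairaSymbolOfMinimal_eq_*`, residue field of `𝓞_v` perfect) keeps its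
defining `π`-adic conditions in `𝒪ⁿʳ` (`map_mem_maximalIdeal_pow_iff`,
`distinctRootCount_cubicStep6_map_eq_three`, `distinctRootCount_quadraticStep8_map_eq_two`), so the
elementary index computations of `NeronComponentIndexType*Proofs` over the henselian discrete
valuation ring `𝒪ⁿʳ` give `[J(K_v^nr) : E₀] ∈ {1, 2, 3, 4}` for the normal form, hence for `J`
(`index_nonsingularReductionSubgroup_smul`); for types `II`, `II*` every point has nonsingular
reduction (`a₆_mem_sq_of_equation`, `dvd_a₆_of_equation_IIstar`).  No Néron model and no
minimality over `𝒪ⁿʳ` is used.  (2) *Representatives.*  The finitely many classes of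
`J(K_v^nr)/E₀` have representatives (`QuotientAddGroup.mk_out_eq_mul`), which are pushed into
`X(K̄_v)` along `J ⊗ K_v^nr = X ⊗ K_v^nr` and `K_v^nr ⊆ K̄_v`; their coordinates lie in `K_v^nr`, the
fixed field of `I_𝔐` (`mem_maxUnramified_iff_forall_inertia`).  (3) *Fixed points come from
`K_v^nr`* by the same fixed-field statement, and (4) *`E₀` over `𝒪ⁿʳ` is `E₀` over `𝒪_w`*: a point
of `J(K_v^nr)` with nonsingular reduction maps to a point of `X(K̄_v)` with
`Literature.NumberTheory.EllipticCurves.ReducesToNonsingular` for `|·|_v` (bridge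
`reducesToNonsingular_iff_hasNonsingularReduction` on the `𝒪_w`-model `J ⊗ 𝒪_w`; the residue field
of `𝒪ⁿʳ` embeds into that of `𝒪_w` and nonsingularity is preserved, `Affine.map_nonsingular`).
[cite: SilvermanAEC2009, Cor. VII.6.2, as applied over `K^nr` in the proof of Thm. VII.7.1 (PDF pp. 177–179)]
[cite: SilvermanATAEC1994, Cor. IV.9.2(d) with IV.9.4 and Table 4.1 (PDF pp. 340–346)] -/
theorem _root_.WeierstrassCurve.kodairaNeron_exists_finset_reducesToNonsingular_of_hasAdditiveReductionAt
    (W : WeierstrassCurve K) [W.IsElliptic] (hadd : W.HasAdditiveReductionAt v) :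
    (W.localMinimalModel v).kodairaNeron_exists_finset_reducesToNonsingular := by
  intro _ _ w hw 𝔐 h𝔐
  -- the classical decidable equality on `K_v^nr`, as in the index theorems of the tree
  letI instDec : DecidableEq (maxUnramified (v.adicCompletion K)) := fun a b => Classical.propDecidable (a = b)
  haveI := isDiscreteValuationRing_unrIntegers hw
  haveI := henselianLocalRing_unrIntegers hw
  haveI : PerfectField (ResidueField (v.adicCompletionIntegers K)) := PerfectField.ofFinite
  obtain ⟨φ, hφ⟩ := exists_ringHom_adicCompletionIntegers_unrIntegers hw
  obtain ⟨ψ, hψ⟩ := exists_ringHom_unrIntegers_integer (w := w)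
  have hvR := integers_valuationRing_valuation (Valuation.valuationSubring (Valuation.comap (algebraMap (maxUnramified (v.adicCompletion K)) (AlgebraicClosure (v.adicCompletion K))) w)) (maxUnramified (v.adicCompletion K))
  have hinjR := IsFractionRing.injective (Valuation.valuationSubring (Valuation.comap (algebraMap (maxUnramified (v.adicCompletion K)) (AlgebraicClosure (v.adicCompletion K))) w)) (maxUnramified (v.adicCompletion K))
  haveI hXell : (W.localMinimalModel v).IsElliptic := W.isElliptic_localMinimalModel v
  have hX₀K : (W.localMinimalIntegralModel v).baseChange (v.adicCompletion K) = W.localMinimalModel v :=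
    WeierstrassCurve.baseChange_integralModel_eq (v.adicCompletionIntegers K) (W.localMinimalModel v)
  have hΔ : (W.localMinimalIntegralModel v).Δ ≠ 0 := fun h0 ↦ by
    have : (W.localMinimalModel v).Δ = 0 := by
      rw [← hX₀K]
      change ((W.localMinimalIntegralModel v).map (algebraMap _ _)).Δ = 0
      rw [WeierstrassCurve.map_Δ, h0, map_zero]
    exact hXell.isUnit.ne_zero this
  have hsym : (W.localMinimalIntegralModel v).kodairaSymbolOfMinimal.IsAdditive := by
    have h := (WeierstrassCurve.isAdditive_kodairaSymbolAt_iff_holds v W).mpr hadd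
    rwa [WeierstrassCurve.kodairaSymbolAt_def] at h
  /- (1) the index of `E₀` in `J(K_v^nr)`, `J = X₀ ⊗ 𝒪ⁿʳ`, is finite -/
  have hidx0 : ∀ (X₀ : WeierstrassCurve (v.adicCompletionIntegers K)), X₀.Δ ≠ 0 → X₀.kodairaSymbolOfMinimal.IsAdditive →
      ((X₀.map φ).nonsingularReductionSubgroup hvR).index ≠ 0 := by
    intro X₀ hΔ hs
    -- transfer of the `π`-adic conditions
    have T : ∀ (a : (v.adicCompletionIntegers K)) (k : ℕ), a ∈ maximalIdeal (v.adicCompletionIntegers K) ^ k → φ a ∈ maximalIdeal (Valuation.valuationSubring (Valuation.comap (algebraMap (maxUnramified (v.adicCompletion K)) (AlgebraicClosure (v.adicCompletion K))) w)) ^ k :=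
      fun a k h ↦ (map_mem_maximalIdeal_pow_iff hw hφ a k).mpr h
    have T1 : ∀ a : (v.adicCompletionIntegers K), a ∈ maximalIdeal (v.adicCompletionIntegers K) → φ a ∈ maximalIdeal (Valuation.valuationSubring (Valuation.comap (algebraMap (maxUnramified (v.adicCompletion K)) (AlgebraicClosure (v.adicCompletion K))) w)) :=
      fun a h ↦ (map_mem_maximalIdeal_iff hw hφ a).mpr h
    have N : ∀ (a : (v.adicCompletionIntegers K)) (k : ℕ), a ∉ maximalIdeal (v.adicCompletionIntegers K) ^ k → φ a ∉ maximalIdeal (Valuation.valuationSubring (Valuation.comap (algebraMap (maxUnramified (v.adicCompletion K)) (AlgebraicClosure (v.adicCompletion K))) w)) ^ k :=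
      fun a k h h' ↦ h ((map_mem_maximalIdeal_pow_iff hw hφ a k).mp h')
    have hΔφ : ∀ D : WeierstrassCurve.VariableChange (v.adicCompletionIntegers K), ((D • X₀).map φ).Δ ≠ 0 := fun D h0 ↦ by
      rw [WeierstrassCurve.map_Δ, WeierstrassCurve.variableChange_Δ, map_mul,
        mul_eq_zero] at h0
      rcases h0 with h0 | h0
      · exact (((D.u⁻¹ ^ 12).isUnit.map φ).ne_zero) (by simpa using h0)
      · exact hΔ (injective_of_coe_eq_algebraMap hφ (by rw [h0, map_zero]))
    have hidx : ∀ D : WeierstrassCurve.VariableChange (v.adicCompletionIntegers K),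
        (((D • X₀).map φ).nonsingularReductionSubgroup hvR).index =
        ((X₀.map φ).nonsingularReductionSubgroup hvR).index := fun D ↦ by
      rw [← WeierstrassCurve.map_variableChange]
      exact index_nonsingularReductionSubgroup_smul (X₀.map φ) (D.map φ)
    have hall : ∀ J : WeierstrassCurve (Valuation.valuationSubring (Valuation.comap (algebraMap (maxUnramified (v.adicCompletion K)) (AlgebraicClosure (v.adicCompletion K))) w)),
        (∀ a b : (Valuation.valuationSubring (Valuation.comap (algebraMap (maxUnramified (v.adicCompletion K)) (AlgebraicClosure (v.adicCompletion K))) w)), J.toAffine.Equation a b →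
          ¬ (J.map (residue (Valuation.valuationSubring (Valuation.comap (algebraMap (maxUnramified (v.adicCompletion K)) (AlgebraicClosure (v.adicCompletion K))) w)))).toAffine.Nonsingular (residue (Valuation.valuationSubring (Valuation.comap (algebraMap (maxUnramified (v.adicCompletion K)) (AlgebraicClosure (v.adicCompletion K))) w)) a) (residue (Valuation.valuationSubring (Valuation.comap (algebraMap (maxUnramified (v.adicCompletion K)) (AlgebraicClosure (v.adicCompletion K))) w)) b) → False) →
        (J.nonsingularReductionSubgroup hvR).index = 1 := by
      intro J hJ
      rw [AddSubgroup.index_eq_one, eq_top_iff]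
      intro P _
      rw [WeierstrassCurve.mem_nonsingularReductionSubgroup_iff]
      rcases point_cases hvR P with rfl | ⟨x, y, h, rfl, hx⟩ | ⟨a, b, h, rfl⟩
      · trivial
      · exact Or.inl ((not_mem_range_iff hvR).mpr hx)
      · refine (WeierstrassCurve.hasNonsingularReduction_some_algebraMap_iff hinjR h).mpr ?_
        have he : J.toAffine.Equation a b :=
          (WeierstrassCurve.Affine.map_equation _ hinjR a b).mp h.left
        by_contra hns
        exact hJ a b he hns
    generalize hs' : X₀.kodairaSymbolOfMinimal = s at hs
    cases s with
    | I n =>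
      exfalso
      rcases Nat.eq_zero_or_pos n with rfl | hn
      · exact hs.1 rfl
      · exact hs.2 ⟨n, hn.ne', rfl⟩
    | II =>
      obtain ⟨hΔm, -, ha₆⟩ := kodairaSymbolOfMinimal_eq_II_imp X₀ hs'
      have hex := exists_variableChange_step2_of_perfectField X₀ hΔm
      rw [show normalizeStep2 X₀ = hex.choose • X₀ from dif_pos hex] at ha₆
      obtain ⟨-, h3, h4, h6⟩ := hex.choose_spec
      have key := hall ((hex.choose • X₀).map φ) fun a b he hns ↦ by
        obtain ⟨ha, hb⟩ := mem_maximalIdeal_of_not_nonsingular (T1 _ h3) (T1 _ h4) (T1 _ h6) he hns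
        exact N _ 2 ha₆ (a₆_mem_sq_of_equation (T1 _ h3) (T1 _ h4) he ha hb)
      rw [hidx] at key
      omega
    | III =>
      obtain ⟨D, h1, h2, h3, h4, h4', h6⟩ := exists_smul_of_kodairaSymbolOfMinimal_eq_III X₀ hs'
      have key := index_eq_two_of_normalForm_III (K := (maxUnramified (v.adicCompletion K))) ((D • X₀).map φ) (hΔφ D) (T1 _ h1)
        (T1 _ h2) (T1 _ h3) (T1 _ h4) (N _ 2 h4') (T _ 2 h6)
      rw [hidx] at key
      omega
    | IV =>
      obtain ⟨D, h1, h2, h3, h4, h6, hb₆⟩ := exists_smul_of_kodairaSymbolOfMinimal_eq_IV X₀ hs'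
      have hb₆' : ((D • X₀).map φ).b₆ ∉ maximalIdeal (Valuation.valuationSubring (Valuation.comap (algebraMap (maxUnramified (v.adicCompletion K)) (AlgebraicClosure (v.adicCompletion K))) w)) ^ 3 := by
        rw [WeierstrassCurve.map_b₆]; exact N _ 3 hb₆
      have key := index_mem_of_normalForm_IV (K := (maxUnramified (v.adicCompletion K))) ((D • X₀).map φ) (T1 _ h1) (T1 _ h2)
        (T1 _ h3) (T _ 2 h4) (T _ 2 h6) hb₆'
      rw [hidx] at key
      omega
    | Istar n =>
      cases n with
      | zero =>
        obtain ⟨D, h1, h2, h3, h4, h6, hP3⟩ :=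
          exists_smul_of_kodairaSymbolOfMinimal_eq_Istar_zero X₀ hΔ hs'
        have hP3' := distinctRootCount_cubicStep6_map_eq_three hw hφ (D • X₀) h2 h4 h6 hP3
        have key := index_mem_of_normalForm_Istar_zero (K := (maxUnramified (v.adicCompletion K))) ((D • X₀).map φ) (T1 _ h1)
          (T1 _ h2) (T _ 2 h3) (T _ 2 h4) (T _ 3 h6) hP3'
        rw [hidx] at key
        omega
      | succ n =>
        obtain ⟨D, h1, h2, h2', h3, h4, h6⟩ :=
          exists_smul_of_kodairaSymbolOfMinimal_eq_Istar_succ X₀ hs'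
        have key := index_mem_of_normalForm_Istar_succ (K := (maxUnramified (v.adicCompletion K))) ((D • X₀).map φ) (hΔφ D)
          (T1 _ h1) (T1 _ h2) (N _ 2 h2') (T _ 2 h3) (T _ 3 h4) (T _ 4 h6)
        rw [hidx] at key
        omega
    | IVstar =>
      obtain ⟨D, h1, h2, h3, h4, h6, h8⟩ := exists_smul_of_kodairaSymbolOfMinimal_eq_IVstar X₀ hs'
      have h8' := distinctRootCount_quadraticStep8_map_eq_two hw hφ (D • X₀) h3 h6 h8
      have key := index_mem_of_normalForm_IVstar (K := (maxUnramified (v.adicCompletion K))) ((D • X₀).map φ) (T1 _ h1) (T _ 2 h2)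
        (T _ 2 h3) (T _ 3 h4) (T _ 4 h6) h8'
      rw [hidx] at key
      omega
    | IIIstar =>
      obtain ⟨D, h1, h2, h3, h4, h4', h6⟩ :=
        exists_smul_of_kodairaSymbolOfMinimal_eq_IIIstar X₀ hs'
      have key := index_eq_two_of_normalForm_IIIstar (K := (maxUnramified (v.adicCompletion K))) ((D • X₀).map φ) (hΔφ D) (T1 _ h1)
        (T _ 2 h2) (T _ 3 h3) (T _ 3 h4) (N _ 4 h4') (T _ 5 h6)
      rw [hidx] at key
      omega
    | IIstar =>
      obtain ⟨D, h1, h2, h3, h4, h6, h6'⟩ := exists_smul_of_kodairaSymbolOfMinimal_eq_IIstar X₀ hs'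
      have key := hall ((D • X₀).map φ) fun a b he hns ↦ by
        obtain ⟨ha, hb⟩ := mem_maximalIdeal_of_not_nonsingular
          (Ideal.pow_le_self three_ne_zero (T _ 3 h3))
          (Ideal.pow_le_self four_ne_zero (T _ 4 h4)) (Ideal.pow_le_self (by norm_num) (T _ 5 h6))
          he hns
        apply N _ 6 h6'
        have hd := dvd_a₆_of_equation_IIstar (irreducible_uniformizer (R := (Valuation.valuationSubring (Valuation.comap (algebraMap (maxUnramified (v.adicCompletion K)) (AlgebraicClosure (v.adicCompletion K))) w))))
          (mem_maximalIdeal_iff_dvd.mp (T1 _ h1)) (mem_maximalIdeal_pow_iff_dvd.mp (T _ 2 h2))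
          (mem_maximalIdeal_pow_iff_dvd.mp (T _ 3 h3)) (mem_maximalIdeal_pow_iff_dvd.mp (T _ 4 h4))
          (mem_maximalIdeal_pow_iff_dvd.mp (T _ 5 h6)) he (mem_maximalIdeal_iff_dvd.mp ha)
          (mem_maximalIdeal_iff_dvd.mp hb)
        exact mem_maximalIdeal_pow_iff_dvd.mpr hd
      rw [hidx] at key
      omega
  /- the model `J = X₀ ⊗ 𝒪ⁿʳ`, its base changes to `K_v^nr` and to `𝒪_w`, `K̄_v` -/
  have hJ : ((W.localMinimalIntegralModel v).map φ).baseChange (maxUnramified (v.adicCompletion K)) =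
      (W.localMinimalModel v).baseChange (maxUnramified (v.adicCompletion K)) := by
    rw [← hX₀K]
    change ((W.localMinimalIntegralModel v).map φ).map (algebraMap _ _) =
      ((W.localMinimalIntegralModel v).map (algebraMap (v.adicCompletionIntegers K) (v.adicCompletion K))).map (algebraMap (v.adicCompletion K) (maxUnramified (v.adicCompletion K)))
    rw [WeierstrassCurve.map_map, WeierstrassCurve.map_map]
    congr 1
    refine RingHom.ext fun a ↦ Subtype.ext ?_
    change (((φ a : (Valuation.valuationSubring (Valuation.comap (algebraMap (maxUnramified (v.adicCompletion K)) (AlgebraicClosure (v.adicCompletion K))) w))) : (maxUnramified (v.adicCompletion K))) : (AlgebraicClosure (v.adicCompletion K))) = ((algebraMap (v.adicCompletion K) (maxUnramified (v.adicCompletion K)) (algebraMap (v.adicCompletionIntegers K) (v.adicCompletion K) a) : (maxUnramified (v.adicCompletion K))) : (AlgebraicClosure (v.adicCompletion K)))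
    rw [hφ, IntermediateField.coe_algebraMap_apply]
    rfl
  have hW₀ : (((W.localMinimalIntegralModel v).map φ).map ψ).baseChange (AlgebraicClosure (v.adicCompletion K)) =
      (W.localMinimalModel v).baseChange (AlgebraicClosure (v.adicCompletion K)) := by
    rw [← hX₀K]
    change (((W.localMinimalIntegralModel v).map φ).map ψ).map (algebraMap _ _) =
      ((W.localMinimalIntegralModel v).map (algebraMap (v.adicCompletionIntegers K) (v.adicCompletion K))).map (algebraMap (v.adicCompletion K) (AlgebraicClosure (v.adicCompletion K)))
    rw [WeierstrassCurve.map_map, WeierstrassCurve.map_map, WeierstrassCurve.map_map]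
    congr 1
    refine RingHom.ext fun a ↦ ?_
    change ((ψ (φ a) : w.integer) : (AlgebraicClosure (v.adicCompletion K))) = algebraMap (v.adicCompletion K) (AlgebraicClosure (v.adicCompletion K)) (algebraMap (v.adicCompletionIntegers K) (v.adicCompletion K) a)
    rw [hψ, hφ]
    rfl
  -- the residue field of `𝒪ⁿʳ` embeds into that of `𝒪_w`
  haveI hψloc : IsLocalHom ψ := ⟨fun a ha ↦ by
    by_contra hna
    have hmem : a ∈ maximalIdeal (Valuation.valuationSubring (Valuation.comap (algebraMap (maxUnramified (v.adicCompletion K)) (AlgebraicClosure (v.adicCompletion K))) w)) := (IsLocalRing.mem_maximalIdeal _).mpr (mem_nonunits_iff.mpr hna)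
    have := (map_mem_maximalIdeal_integer_iff hψ a).mpr hmem
    exact (mem_nonunits_iff.mp ((IsLocalRing.mem_maximalIdeal _).mp this)) ha⟩
  have hκ : (((W.localMinimalIntegralModel v).map φ).map ψ).map (residue w.integer) =
      ((((W.localMinimalIntegralModel v).map φ).map (residue (Valuation.valuationSubring (Valuation.comap (algebraMap (maxUnramified (v.adicCompletion K)) (AlgebraicClosure (v.adicCompletion K))) w)))).map
        (IsLocalRing.ResidueField.map ψ)) := by
    simp only [WeierstrassCurve.map_map]
    congr 1
  /- the maps on points: `J(K_v^nr) ≃ X(K_v^nr) → X(K̄_v)` -/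
  set e₁ := WeierstrassCurve.Affine.Point.congrEquiv hJ with he₁
  set ι : ((W.localMinimalModel v).baseChange (maxUnramified (v.adicCompletion K))).toAffine.Point →+
      ((W.localMinimalModel v).baseChange (AlgebraicClosure (v.adicCompletion K))).toAffine.Point :=
    WeierstrassCurve.Affine.Point.map (W' := W.localMinimalModel v) (IsScalarTower.toAlgHom (v.adicCompletion K) (maxUnramified (v.adicCompletion K)) (AlgebraicClosure (v.adicCompletion K))) with hι
  -- (2) images of `K_v^nr`-points are fixed by `I_𝔐`
  have hfixι : ∀ (Q : ((W.localMinimalModel v).baseChange (maxUnramified (v.adicCompletion K))).toAffine.Point),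
      ∀ σ ∈ 𝔐.inertia (absoluteGaloisGroup (v.adicCompletion K)),
        WeierstrassCurve.Affine.Point.map ((absoluteGaloisGroup.toAlgEquiv _ σ : (AlgebraicClosure (v.adicCompletion K)) ≃ₐ[(v.adicCompletion K)] (AlgebraicClosure (v.adicCompletion K))) : (AlgebraicClosure (v.adicCompletion K)) →ₐ[(v.adicCompletion K)] (AlgebraicClosure (v.adicCompletion K)))
          (ι Q) = ι Q := by
    intro Q σ hσ
    rcases Q with _ | ⟨x, y, h⟩
    · rfl
    · change WeierstrassCurve.Affine.Point.map _ (WeierstrassCurve.Affine.Point.some _ _ _) = WeierstrassCurve.Affine.Point.some _ _ _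
      rw [WeierstrassCurve.Affine.Point.map_some]
      exact point_some_congr (smul_coe_maxUnramified hw h𝔐 x hσ) (smul_coe_maxUnramified hw h𝔐 y hσ)
  -- (3) `I_𝔐`-fixed points of `X(K̄_v)` come from `X(K_v^nr)`
  have hsurj : ∀ P : ((W.localMinimalModel v).baseChange (AlgebraicClosure (v.adicCompletion K))).toAffine.Point,
      (∀ σ ∈ 𝔐.inertia (absoluteGaloisGroup (v.adicCompletion K)),
        WeierstrassCurve.Affine.Point.map ((absoluteGaloisGroup.toAlgEquiv _ σ : (AlgebraicClosure (v.adicCompletion K)) ≃ₐ[(v.adicCompletion K)] (AlgebraicClosure (v.adicCompletion K))) : (AlgebraicClosure (v.adicCompletion K)) →ₐ[(v.adicCompletion K)] (AlgebraicClosure (v.adicCompletion K)))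
          P = P) → ∃ Q, ι Q = P := by
    intro P hP
    rcases P with _ | ⟨x, y, h⟩
    · exact ⟨0, map_zero ι⟩
    · have hx : x ∈ maxUnramified (v.adicCompletion K) := (mem_maxUnramified_iff_forall_inertia hw h𝔐).mpr
        fun σ hσ ↦ by
          have := hP σ hσ
          rw [WeierstrassCurve.Affine.Point.map_some, WeierstrassCurve.Affine.Point.some.injEq] at this
          exact this.1
      have hy : y ∈ maxUnramified (v.adicCompletion K) := (mem_maxUnramified_iff_forall_inertia hw h𝔐).mpr
        fun σ hσ ↦ by
          have := hP σ hσ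
          rw [WeierstrassCurve.Affine.Point.map_some, WeierstrassCurve.Affine.Point.some.injEq] at this
          exact this.2
      have hinjι : Function.Injective (IsScalarTower.toAlgHom (v.adicCompletion K) (maxUnramified (v.adicCompletion K)) (AlgebraicClosure (v.adicCompletion K))) :=
        fun a b hab ↦ Subtype.ext hab
      have h₀ : ((W.localMinimalModel v).baseChange (maxUnramified (v.adicCompletion K))).toAffine.Nonsingular ⟨x, hx⟩ ⟨y, hy⟩ :=
        (WeierstrassCurve.Affine.baseChange_nonsingular (W := W.localMinimalModel v)
          (f := IsScalarTower.toAlgHom (v.adicCompletion K) (maxUnramified (v.adicCompletion K)) (AlgebraicClosure (v.adicCompletion K))) hinjι ⟨x, hx⟩ ⟨y, hy⟩).mp h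
      exact ⟨.some _ _ h₀, rfl⟩
  -- (4) `E₀` of `J` over `𝒪ⁿʳ` maps into `E₀` of `X` over `𝒪_w`
  have hE₀ : ∀ Q : (((W.localMinimalIntegralModel v).map φ).baseChange (maxUnramified (v.adicCompletion K))).toAffine.Point,
      ((W.localMinimalIntegralModel v).map φ).HasNonsingularReduction Q →
        ReducesToNonsingular w (residue w.integer) (ι (e₁ Q)) := by
    intro Q hQ
    rcases point_cases hvR Q with rfl | ⟨x, y, h, rfl, hx⟩ | ⟨a, b, h, rfl⟩
    · rw [map_zero, map_zero]
      exact reducesToNonsingular_zero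
    · have hx' : 1 < w (x : (AlgebraicClosure (v.adicCompletion K))) := not_le.mp fun hle ↦
        (not_mem_range_iff hvR).mpr hx ⟨⟨x, (Valuation.mem_valuationSubring_iff _ _).mpr hle⟩, rfl⟩
      rw [he₁, WeierstrassCurve.Affine.Point.congrEquiv_some]
      exact reducesToNonsingular_of_one_lt hx'
    · have hns := (WeierstrassCurve.hasNonsingularReduction_some_algebraMap_iff hinjR h).mp hQ
      rw [he₁, WeierstrassCurve.Affine.Point.congrEquiv_some]
      -- transport to the `𝒪_w`-model `J ⊗ 𝒪_w` of `X ⊗ K̄ᵥ`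
      rw [← (WeierstrassCurve.Affine.Point.congrEquiv hW₀).apply_symm_apply (ι _), reducesToNonsingular_congrEquiv_iff,
        reducesToNonsingular_iff_hasNonsingularReduction]
      change (((W.localMinimalIntegralModel v).map φ).map ψ).HasNonsingularReduction
        ((WeierstrassCurve.Affine.Point.congrEquiv hW₀).symm (WeierstrassCurve.Affine.Point.some _ _ _))
      rw [WeierstrassCurve.Affine.Point.congrEquiv_symm_some]
      refine Or.inr ⟨ψ a, ψ b, hψ a, hψ b, ?_⟩
      rw [hκ, ← IsLocalRing.ResidueField.map_residue, ← IsLocalRing.ResidueField.map_residue]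
      exact (WeierstrassCurve.Affine.map_nonsingular _
        (IsLocalRing.ResidueField.map ψ).injective _ _).mpr hns
  /- representatives -/
  have hfin := hidx0 _ hΔ hsym
  haveI := AddSubgroup.fintypeOfIndexNeZero hfin
  set H := ((W.localMinimalIntegralModel v).map φ).nonsingularReductionSubgroup hvR with hH
  refine ⟨(Finset.univ.image fun q :
      (((W.localMinimalIntegralModel v).map φ).baseChange (maxUnramified (v.adicCompletion K))).toAffine.Point ⧸ H ↦
        ι (e₁ (Quotient.out q))), ?_, ?_⟩
  · intro t ht σ hσ
    obtain ⟨q, -, rfl⟩ := Finset.mem_image.mp ht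
    exact hfixι _ σ hσ
  · intro P hP
    obtain ⟨P₀, rfl⟩ := hsurj P hP
    set Q₀ := e₁.symm P₀ with hQ₀
    obtain ⟨h, hh⟩ := QuotientAddGroup.mk_out_eq_mul H Q₀
    refine ⟨ι (e₁ (Quotient.out (Q₀ : _ ⧸ H))), Finset.mem_image_of_mem _ (Finset.mem_univ _), ?_⟩
    have hP₀ : ι P₀ = ι (e₁ Q₀) := by rw [hQ₀, AddEquiv.apply_symm_apply]
    rw [hP₀, ← map_sub, ← map_sub]
    apply hE₀
    rw [hh, sub_add_cancel_left]
    exact (H.neg_mem h.2 : _)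

end IsDedekindDomain.HeightOneSpectrum

end
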